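import Literature.AlgebraicGeometry.Motives.SmoothLocalCoordinates
import Literature.AlgebraicGeometry.Motives.AbelianVarietyDegree
import HarnessLib

/-!
# Rational top forms on a smooth scheme over a field: frames at a point and on an affine chart

Topic `Literature/AlgebraicGeometry/Motives` (proofs only; no definitions, no named facts), `RatFn`
currency of `CartierDivisor.lean` + `SmoothLocalCoordinates`. Let `X` be an integral `k`-scheme
smooth of relative dimension `n`. A **rational top form** on `X` is written, WITHOUT introducing a
definition, as a pair `(f₀, B₀)` — a rational function `f₀ ∈ K(X)` and a `K(X)`-basis `B₀` of
`Ω[K(X)⁄k]` — standing for `θ = f₀ · (B₀ 1 ∧ … ∧ B₀ n)`. For local coordinates `z` at `x` with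
function-field basis `B_z` (`exists_localCoordinates`, `exists_basis_functionField_of_localCoordinates`)
one has `θ = f₀ · B_z.det B₀ · dz₁ ∧ … ∧ dzₙ`, so «`θ` is a FRAME (generator of `⋀ⁿ Ω[𝒪_{X,x}⁄k]`)
at `x`» is the condition `RatFn.IsUnitAt x (f₀ * B_z.det B₀)`:

* `isUnitAt_mul_det_iff_of_localCoordinates` — the condition does not depend on the coordinates
  `z` at `x` (Jacobian cocycle + `isUnitAt_det_of_localCoordinates`; Bosch–Lütkebohmert–Raynaud
  §2.2 Prop. 11);
* `exists_basis_stalk_of_chart`, `exists_basis_functionField_of_chart` — exact Kähler bases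
  `d yᵢ` of an AFFINE CHART `V` localise to local coordinates at every `x ∈ V` and to a basis of
  `Ω[K(X)⁄k]`;
* `forall_isUnitAt_iff_exists_units` — **a rational function is a unit at every point of an
  affine open `V` iff it is (the image of) a unit of `Γ(X, V)`** (`Γ(V, 𝒪) = ⋂ 𝒪_{X,x}`, ★
  `RatFn.exists_germ_eq_of_forall_isRegularAt`, Görtz–Wedhorn I Prop. 3.29 (3));
* `frame_on_chart_iff` — hence **`θ = (f₀, B₀)` is a frame at every point of `V` iff its chart
  coefficient `f₀ · B_V.det B₀` is a unit of `Γ(X, V)`** — the form in which Bosch–Lütkebohmert–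
  Raynaud §4.2 («`ω` generates `Ω^d` over `U`») / Edixhoven–Romagny §6 Lemma is consumed.

The `k`-algebra structure of `Γ(X, V)` is taken as an ARGUMENT `[Algebra k Γ(X, V)]
[IsScalarTower k Γ(X, V) X.functionField]` (any structure compatible with `RatFn.algebraStalk` on
`K(X)`), so that no definition is introduced. Cell `hodgecm-mathlib`, road W of `r₀` ((W0) leaf L4a
infrastructure 3/3).

## Sources

* S. Bosch, W. Lütkebohmert, M. Raynaud, *Néron Models*, Springer 1990, §2.2 Prop. 11 / §4.2
  (invariant differential forms generate `Ω^d`). [BLRNeronModels1990]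
* U. Görtz, T. Wedhorn, *Algebraic Geometry I*, 2nd ed. 2020, Prop. 3.29 (3). [GortzWedhorn2020]
-/

noncomputable section

universe u

open CategoryTheory AlgebraicGeometry Opposite

namespace Literature.AlgebraicGeometry.Motives

open RatFn

variable {k : Type u} [Field k] {X : Scheme.{u}} [IsIntegral X] [X.Over (Spec (.of k))] (n : ℕ)

/-! ### Independence of the frame condition from the coordinates -/

/-- **The frame condition at `x` does not depend on the local coordinates**: for two systems of
coordinates `z, z'` at `x` (function-field bases `B, B'`) and any rational top form `(f₀, B₀)`,
`f₀ · B.det B₀` is a unit at `x` iff `f₀ · B'.det B₀` is (the Jacobian `B'.det B` is a unit at `x`,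
`isUnitAt_det_of_localCoordinates`, and `B'.det B₀ = B'.det B · B.det B₀`).
[cite: BLRNeronModels1990, §2.2 Prop. 11] -/
theorem isUnitAt_mul_det_iff_of_localCoordinates {x : X} {z z' : Fin n → X.presheaf.stalk x}
    (b : Module.Basis (Fin n) (X.presheaf.stalk x) Ω[X.presheaf.stalk x⁄k])
    (hb : ∀ i, b i = KaehlerDifferential.D k _ (z i))
    (b' : Module.Basis (Fin n) (X.presheaf.stalk x) Ω[X.presheaf.stalk x⁄k])
    (hb' : ∀ i, b' i = KaehlerDifferential.D k _ (z' i))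
    {B B' : Module.Basis (Fin n) X.functionField Ω[X.functionField⁄k]}
    (hB : ∀ i, B i = KaehlerDifferential.D k _ (toFunctionField x (z i)))
    (hB' : ∀ i, B' i = KaehlerDifferential.D k _ (toFunctionField x (z' i)))
    (f₀ : X.functionField) (B₀ : Module.Basis (Fin n) X.functionField Ω[X.functionField⁄k]) :
    IsUnitAt x (f₀ * B.det B₀) ↔ IsUnitAt x (f₀ * B'.det B₀) := by
  have hJ : IsUnitAt x (B'.det B) := (isUnitAt_det_of_localCoordinates n b hb b' hb' hB hB').2
  have hcoc : B'.det B₀ = B'.det B * B.det B₀ := (det_mul_det_basis B₀ B B').symm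
  constructor
  · intro h
    rw [hcoc, mul_left_comm]
    exact hJ.mul h
  · intro h
    have h' : IsUnitAt x ((f₀ * B'.det B₀) * (B'.det B)⁻¹) := h.mul hJ.inv
    rwa [hcoc, mul_comm (B'.det ⇑B) (B.det ⇑B₀), ← mul_assoc,
      mul_inv_cancel_right₀ hJ.ne_zero] at h'

/-! ### Affine charts with an exact Kähler basis -/

section Chart

variable {V : X.Opens} (hV : IsAffineOpen V) [Algebra k Γ(X, V)]

/-- `k → Γ(X, V) → 𝒪_{X,x}` is a scalar tower as soon as `k → Γ(X, V) → K(X)` is (the maps to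
`K(X)` are injective; private plumbing). [folklore] -/
private theorem isScalarTower_stalk_of_chart [Nonempty V]
    [IsScalarTower k Γ(X, V) X.functionField] {x : X} (hx : x ∈ V) :
    letI : Algebra Γ(X, V) (X.presheaf.stalk x) := (X.presheaf.germ V x hx).hom.toAlgebra
    IsScalarTower k Γ(X, V) (X.presheaf.stalk x) := by
  letI : Algebra Γ(X, V) (X.presheaf.stalk x) := (X.presheaf.germ V x hx).hom.toAlgebra
  refine IsScalarTower.of_algebraMap_eq fun c => toFunctionField_injective x ?_
  rw [← IsScalarTower.algebraMap_apply k (X.presheaf.stalk x) X.functionField,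
    IsScalarTower.algebraMap_apply k Γ(X, V) X.functionField, RingHom.algebraMap_toAlgebra]
  change _ = toFunctionField x (X.presheaf.germ V x hx _)
  rw [toFunctionField_germ]

include hV in
/-- **Chart coordinates are local coordinates**: an exact basis `d y₁, …, d yₙ` of `Ω[Γ(X, V)⁄k]`
on an affine open `V` localises, at every `x ∈ V`, to a basis `d yᵢ` of `Ω[𝒪_{X,x}⁄k]`
(`𝒪_{X,x} = Γ(V)_{𝔭_x}`, `Ω` commutes with localisation). [cite: BLRNeronModels1990, §2.2 Prop. 11] -/
theorem exists_basis_stalk_of_chart [Nonempty V] [IsScalarTower k Γ(X, V) X.functionField]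
    {y : Fin n → Γ(X, V)} (bV : Module.Basis (Fin n) Γ(X, V) Ω[Γ(X, V)⁄k])
    (hbV : ∀ i, bV i = KaehlerDifferential.D k _ (y i)) {x : X} (hx : x ∈ V) :
    ∃ b : Module.Basis (Fin n) (X.presheaf.stalk x) Ω[X.presheaf.stalk x⁄k],
      ∀ i, b i = KaehlerDifferential.D k _ (X.presheaf.germ V x hx (y i)) := by
  letI : Algebra Γ(X, V) (X.presheaf.stalk x) := (X.presheaf.germ V x hx).hom.toAlgebra
  haveI := isScalarTower_stalk_of_chart (k := k) (V := V) hx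
  haveI : IsLocalization.AtPrime (X.presheaf.stalk x) (hV.primeIdealOf ⟨x, hx⟩).asIdeal :=
    hV.isLocalization_stalk ⟨x, hx⟩
  exact exists_basis_kaehler_localization_eq_D (X.presheaf.stalk x)
    (hV.primeIdealOf ⟨x, hx⟩).asIdeal.primeCompl bV hbV

include hV in
/-- **Chart coordinates give a basis of `Ω[K(X)⁄k]`**: the images in `K(X)` of an exact basis
`d y₁, …, d yₙ` of `Ω[Γ(X, V)⁄k]` form a `K(X)`-basis of `Ω[K(X)⁄k]` (`K(X) = Frac Γ(X, V)` for an
affine open of an integral scheme, Mathlib `functionField_isFractionRing_of_isAffineOpen`).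
[cite: BLRNeronModels1990, §2.2 Prop. 11] -/
theorem exists_basis_functionField_of_chart [Nonempty V] [IsScalarTower k Γ(X, V) X.functionField]
    {y : Fin n → Γ(X, V)} (bV : Module.Basis (Fin n) Γ(X, V) Ω[Γ(X, V)⁄k])
    (hbV : ∀ i, bV i = KaehlerDifferential.D k _ (y i)) :
    ∃ BV : Module.Basis (Fin n) X.functionField Ω[X.functionField⁄k],
      ∀ i, BV i = KaehlerDifferential.D k _ (algebraMap Γ(X, V) X.functionField (y i)) := by
  haveI := functionField_isFractionRing_of_isAffineOpen X V hV
  exact exists_basis_kaehler_localization_eq_D X.functionField (nonZeroDivisors Γ(X, V)) bV hbV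

omit [X.Over (Spec (.of k))] [Algebra k Γ(X, V)] in
/-- **`Γ(V, 𝒪_X)ˣ = {h ∈ K(X) : h ∈ 𝒪_{X,x}ˣ for all x ∈ V}`** for an affine open `V` of an integral
scheme (Görtz–Wedhorn I, Prop. 3.29 (3), applied to `h` and `h⁻¹`; `Γ(V) → K(X)` is injective).
[cite: GortzWedhorn2020, Prop. 3.29 (3)] -/
theorem forall_isUnitAt_iff_exists_units [Nonempty V] (h : X.functionField) :
    (∀ x ∈ V, IsUnitAt x h) ↔ ∃ u : Γ(X, V)ˣ, algebraMap Γ(X, V) X.functionField u = h := by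
  obtain ⟨⟨v₀, hv₀⟩⟩ := ‹Nonempty V›
  have hξ : genericPoint X ∈ V :=
    ((genericPoint_spec X).mem_open_set_iff V.isOpen).2 ⟨v₀, Set.mem_univ _, hv₀⟩
  have halg : ∀ s : Γ(X, V), algebraMap Γ(X, V) X.functionField s =
      X.presheaf.germ V (genericPoint X) hξ s := fun s => rfl
  constructor
  · intro hh
    obtain ⟨σ, hσ⟩ := exists_germ_eq_of_forall_isRegularAt hξ fun y hy => (hh y hy).isRegularAt
    obtain ⟨τ, hτ⟩ := exists_germ_eq_of_forall_isRegularAt hξ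
      fun y hy => ((hh y hy).inv).isRegularAt
    have h0 : h ≠ 0 := (hh v₀ hv₀).ne_zero
    have hστ : σ * τ = 1 := by
      apply Scheme.germToFunctionField_injective X V
      change X.presheaf.germ V (genericPoint X) hξ (σ * τ) = X.presheaf.germ V (genericPoint X) hξ 1
      rw [map_mul, map_one, hσ, hτ, mul_inv_cancel₀ h0]
    exact ⟨⟨σ, τ, hστ, by rw [mul_comm, hστ]⟩, by rw [halg]; exact hσ⟩
  · rintro ⟨u, rfl⟩ x hx
    rw [halg, germ_genericPoint_eq_toFunctionField hx]
    exact ⟨(Units.map (X.presheaf.germ V x hx).hom.toMonoidHom u), rfl⟩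

include hV in
/-- **Frame on a chart.** Let `V` be an affine open with exact Kähler basis `d yᵢ` (function-field
basis `B_V`), and `θ = (f₀, B₀)` a rational top form. Then `θ` is a frame at every point of `V`
— for every `x ∈ V` and every system of local coordinates at `x` the condition
`IsUnitAt x (f₀ · B_z.det B₀)` holds — iff the chart coefficient `f₀ · B_V.det B₀` is a unit of
`Γ(X, V)` (Bosch–Lütkebohmert–Raynaud §4.2: «`ω` generates `Ω^d` over `U`»).
[cite: BLRNeronModels1990, §4.2 (Prop. 1) with §2.2 Prop. 11] -/
theorem frame_on_chart_iff [Nonempty V] [IsScalarTower k Γ(X, V) X.functionField]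
    [SmoothOfRelativeDimension n (X ↘ Spec (.of k))]
    {y : Fin n → Γ(X, V)} (bV : Module.Basis (Fin n) Γ(X, V) Ω[Γ(X, V)⁄k])
    (hbV : ∀ i, bV i = KaehlerDifferential.D k _ (y i))
    {BV : Module.Basis (Fin n) X.functionField Ω[X.functionField⁄k]}
    (hBV : ∀ i, BV i = KaehlerDifferential.D k _ (algebraMap Γ(X, V) X.functionField (y i)))
    (f₀ : X.functionField) (B₀ : Module.Basis (Fin n) X.functionField Ω[X.functionField⁄k]) :
    (∀ x ∈ V, ∀ (z : Fin n → X.presheaf.stalk x)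
        (b : Module.Basis (Fin n) (X.presheaf.stalk x) Ω[X.presheaf.stalk x⁄k])
        (_ : ∀ i, b i = KaehlerDifferential.D k _ (z i))
        (B : Module.Basis (Fin n) X.functionField Ω[X.functionField⁄k])
        (_ : ∀ i, B i = KaehlerDifferential.D k _ (toFunctionField x (z i))),
        IsUnitAt x (f₀ * B.det B₀)) ↔
      ∃ u : Γ(X, V)ˣ, algebraMap Γ(X, V) X.functionField u = f₀ * BV.det B₀ := by
  rw [← forall_isUnitAt_iff_exists_units]
  -- at `x ∈ V` the germs of `y` are local coordinates with function-field basis `B_V`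
  have key : ∀ x (hx : x ∈ V), ∃ (b : Module.Basis (Fin n) (X.presheaf.stalk x)
      Ω[X.presheaf.stalk x⁄k]), (∀ i, b i = KaehlerDifferential.D k _ (X.presheaf.germ V x hx (y i))) ∧
      ∀ i, BV i = KaehlerDifferential.D k _ (toFunctionField x (X.presheaf.germ V x hx (y i))) := by
    intro x hx
    obtain ⟨b, hb⟩ := exists_basis_stalk_of_chart n hV bV hbV hx
    refine ⟨b, hb, fun i => ?_⟩
    rw [hBV, toFunctionField_germ]
    rfl
  constructor
  · intro H x hx
    obtain ⟨b, hb, hBV'⟩ := key x hx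
    exact H x hx _ b hb BV hBV'
  · intro H x hx z b hb B hB
    obtain ⟨b₁, hb₁, hBV'⟩ := key x hx
    exact (isUnitAt_mul_det_iff_of_localCoordinates n b₁ hb₁ b hb hBV' hB f₀ B₀).1 (H x hx)

end Chart

end Literature.AlgebraicGeometry.Motives

end
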